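import Literature.NumberTheory.EllipticCurves.IwasawaOrderKernelRankProofs
import Literature.NumberTheory.EllipticCurves.KatoRankBoundProofs
import Literature.NumberTheory.EllipticCurves.BSDSelmerPConverseHeegnerMainConjectureProofs
import HarnessLib

/-!
# The derived coinvariant profile of an Iwasawa module, I: `ℓ_{(T)}(X) = ∑_{i ≥ 1} e_i(X)`
# (the algebraic skeleton of the Bertolini–Darmon / Howard derived `p`-adic heights) — helper

Cell `bsd-rank2`, seat p2 (GEN 69), `--supports` the open leaf `DepletedLambdaLawAtTwoModNSF` of route
`EisensteinDepletionAtTwo` (sub-problem `Rank2`): the purpose asks what `p`-adic BSD gives at rank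
`≥ 2` as kernel theorems "(… higher `p`-adic Gross–Zagier) and the exact extra input that turns the
inequality into equality". The tree already has, at a point `(E, p)` and modulo Kato's divisibility
(KD) and Mazur control (CT), the chain `rank ≤ corank Sel = rank X/TX ≤ ℓ_{(T)}(X) ≤ ord_{T=0} L_p`
and the three legs (Ш), (SS), (MC_T) of equality (`PAdicOrderV2PadicBSDrankExact`). This file and its
sequel `DerivedCoinvariantProfileAtPoint` make the middle link QUANTITATIVE.

## The object

For a `Λ = ℤ_p⟦T⟧`-module `X` let `T^i X ⊇ T^{i+1} X` be the `T`-adic filtration (`powFil`) and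
`e_{i+1}(X) := ℓ_{(T)}(T^i X / T^{i+1} X) = rank_{ℤ_p}(T^i X/T^{i+1} X)` (`derivedLength X i`, in `ℕ∞`)
its **derived coinvariant profile**: `e_1(X) = rank_{ℤ_p} X/TX` is the classical coinvariant rank and,
for `X_{(T)} ≅ ⊕_j Λ_{(T)}/(T^{a_j})`, `e_{i+1} = #{j : a_j > i}`. DICTIONARY (Pontryagin duality,
`J = (T)`): `e_r(X(E/ℚ_∞)) = dim_{ℚ_p} S_p^{(r)}(E/ℚ)`, the domain of the `r`-th DERIVED `p`-adic
height `h^{(r)} : S^{(r)} × S^{(r)} → J^r/J^{r+1} ⊗ ℚ_p`, whose kernel is `S^{(r+1)}`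
(Howard 2004, Thm. 5.2: "`dim_{ℚ_p} S_p^{(r)}(A/F) = rank(J^{r-1}X/J^rX)`"; Bertolini–Darmon 1995 §2).

## Results (all sorry-free; `X` any `Λ`-module unless said)

* §2 `lengthAt_eq_sum_derivedLength` — **profile law**: if `a · X = 0`, `a ≠ 0`, then
  `ℓ_{(T)}(X) = ∑_{i < n} e_{i+1}(X)` for `n ≥ ord_T a`, and `e_{n+1}(X) = 0`
  (`derivedLength_eq_zero_of_le`); existence form for finitely generated torsion `X`
  (`exists_lengthAt_eq_sum_derivedLength`); `ord_T f = ∑ e_i` for `char X = (f)`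
  (`order_charGenerator_eq_sum_derivedLength`). Partition conjugation `∑_j a_j = ∑_i #{j : a_j > i}`,
  proved by telescoping the additivity of local length along `T^{i+1}X ↪ T^iX ↠ gr_i X` and killing
  the tail `T^n X` by `b = a/T^{ord a} ∉ (T)`.
* §3 `derivedLength_eq_toENat_rank` (`e_{i+1} = rank_{ℤ_p} gr_i`), `derivedLength_zero_eq_coinvariantsRank`
  (`e_1 = rank_{ℤ_p} X/TX`).
* §4 `derivedLength_succ_le` — the profile is non-increasing (`T : gr_i ↠ gr_{i+1}`), hence vanishes
  from the first zero on (`derivedLength_eq_zero_of_eq_zero`), and `e_{i+1} ≤ ℓ_{(T)}(X)`.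

New relative to the tree: the graded object `e_•(X)` and the laws `ℓ_{(T)} = ∑ e_i`, monotonicity
(the tree had `e_1 ≤ ℓ_{(T)}`, `KatoRankBoundProofs`, and the semisimplicity dichotomy
`order_charGenerator_eq_coinvariantsRank_iff`). Barrier-B1 honesty: pure commutative algebra; no claim
on S0. References: [BertoliniDarmon1995] M. Bertolini, H. Darmon, *Derived p-adic heights*, Amer. J.
Math. 117 (1995), §2; [Howard2004DerivedHeights] B. Howard, *Derived p-adic heights and p-adic
L-functions*, Amer. J. Math. 126 (2004) (arXiv:1202.6343), Thm. 5.2, Cor. 5.3; [Washington1997] §13.2;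
[GreenbergLNM1716] §1.
-/

-- D-0017: single-problem summit, so `Summit.BirchSwinnertonDyer.BirchSwinnertonDyer.…` repeats a
-- namespace BY DESIGN.
set_option linter.dupNamespace false

noncomputable section

open scoped BigOperators

universe u

namespace Summit.BirchSwinnertonDyer.BirchSwinnertonDyer.Theorems.DerivedCoinvariantProfile

open Literature.NumberTheory.EllipticCurves Literature.NumberTheory.EllipticCurves.IwasawaAlgebra

variable (p : ℕ) [Fact p.Prime]
variable (M : Type u) [AddCommGroup M] [Module (IwasawaAlgebra p) M]

/-! ## §1 The `T`-adic filtration `T^i X` and its graded pieces -/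

/-- The submodule `T^i X` of a `Λ = ℤ_p⟦T⟧`-module `X` (the image of multiplication by `T^i`).
[cite: Howard2004DerivedHeights, §2 (the filtration `J^{i-1} Sel[J^i]`, dual form)] -/
def powFil (i : ℕ) : Submodule (IwasawaAlgebra p) M :=
  LinearMap.range (LinearMap.lsmul (IwasawaAlgebra p) M ((PowerSeries.X : IwasawaAlgebra p) ^ i))

variable {M} in
/-- Membership in `T^i X`. [folklore] -/
theorem mem_powFil_iff {i : ℕ} {x : M} :
    x ∈ powFil p M i ↔ ∃ y : M, (PowerSeries.X : IwasawaAlgebra p) ^ i • y = x :=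
  LinearMap.mem_range

variable {M} in
/-- `T^i y ∈ T^i X`. [folklore] -/
theorem pow_smul_mem_powFil (i : ℕ) (y : M) :
    (PowerSeries.X : IwasawaAlgebra p) ^ i • y ∈ powFil p M i :=
  (mem_powFil_iff p).mpr ⟨y, rfl⟩

/-- `T^0 X = X`. [folklore] -/
theorem powFil_zero : powFil p M 0 = ⊤ := by
  ext x
  simp only [Submodule.mem_top, iff_true]
  exact (mem_powFil_iff p).mpr ⟨x, by rw [pow_zero, one_smul]⟩

/-- `T^1 X = T X` (the submodule `(T) • X` whose quotient is the tree's `coinvariants p X`).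
[folklore] -/
theorem powFil_one :
    powFil p M 1 = Ideal.span {(PowerSeries.X : IwasawaAlgebra p)} • (⊤ : Submodule (IwasawaAlgebra p) M) := by
  ext x
  rw [mem_powFil_iff, Submodule.ideal_span_singleton_smul, Submodule.mem_smul_pointwise_iff_exists]
  constructor
  · rintro ⟨y, rfl⟩
    exact ⟨y, Submodule.mem_top, by rw [pow_one]⟩
  · rintro ⟨y, -, rfl⟩
    exact ⟨y, by rw [pow_one]⟩

variable {M} in
/-- `T · T^i X ⊆ T^{i+1} X`. [folklore] -/
theorem X_smul_mem_powFil_succ {i : ℕ} {x : M} (hx : x ∈ powFil p M i) :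
    (PowerSeries.X : IwasawaAlgebra p) • x ∈ powFil p M (i + 1) := by
  obtain ⟨y, rfl⟩ := (mem_powFil_iff p).mp hx
  exact (mem_powFil_iff p).mpr ⟨y, by rw [← mul_smul, ← pow_succ']⟩

/-- The filtration decreases: `T^{i+1} X ⊆ T^i X`. [folklore] -/
theorem powFil_succ_le (i : ℕ) : powFil p M (i + 1) ≤ powFil p M i := by
  intro x hx
  obtain ⟨y, rfl⟩ := (mem_powFil_iff p).mp hx
  exact (mem_powFil_iff p).mpr ⟨(PowerSeries.X : IwasawaAlgebra p) • y, by rw [pow_succ, mul_smul]⟩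

/-- The filtration is antitone in `i`. [folklore] -/
theorem powFil_antitone : Antitone (powFil p M) :=
  antitone_nat_of_succ_le (powFil_succ_le p M)

/-- `T^{i+1} X` viewed inside `T^i X`. [folklore] -/
def powFilSucc (i : ℕ) : Submodule (IwasawaAlgebra p) (powFil p M i) :=
  Submodule.comap (powFil p M i).subtype (powFil p M (i + 1))

/-- The `i`-th graded piece `gr_i X = T^i X / T^{i+1} X` of the `T`-adic filtration (so `gr_0 X = X/TX`
are the coinvariants). Its Pontryagin-dual avatar on the discrete side is Howard's
`S^{(i+1)} = J^{i} Sel(K, S_∞)[J^{i+1}] ≅ Sel[J^{i+1}]/Sel[J^{i}]`, the domain of the `(i+1)`-st derived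
`p`-adic height. [cite: Howard2004DerivedHeights, §2 and Thm. 5.2] [cite: BertoliniDarmon1995, §2] -/
abbrev grPiece (i : ℕ) : Type u :=
  (powFil p M i) ⧸ powFilSucc p M i

/-- **The derived coinvariant profile** `e_{i+1}(X) := ℓ_{(T)}(T^i X / T^{i+1} X) ∈ ℕ∞`
(`i = 0, 1, 2, …`): the local length at the augmentation prime `𝔭_T = (T)` of the `i`-th graded
piece. For `X ∼ ⊕_j Λ/(T^{a_j}) ⊕ (T-prime part)` it is `#{j : a_j ≥ i+1}`, the number of Jordan
blocks of `T` of length `> i`; `e_1(X) = rank_{ℤ_p} X/TX` (`derivedLength_zero_eq_coinvariantsRank`).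
[cite: BertoliniDarmon1995, §2] [cite: Howard2004DerivedHeights, Thm. 5.2 and Cor. 5.3] -/
def derivedLength (i : ℕ) : ℕ∞ :=
  Module.lengthAt (IwasawaAlgebra p) (grPiece p M i) (primeT p)

/-- Each graded piece `T^i X / T^{i+1} X` is killed by `T`. [folklore] -/
theorem X_smul_grPiece_eq_zero (i : ℕ) (q : grPiece p M i) :
    (PowerSeries.X : IwasawaAlgebra p) • q = 0 := by
  induction q using Submodule.Quotient.induction_on with
  | H x =>
    rw [← Submodule.Quotient.mk_smul, Submodule.Quotient.mk_eq_zero]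
    show ((PowerSeries.X : IwasawaAlgebra p) • x : powFil p M i).1 ∈ powFil p M (i + 1)
    rw [Submodule.coe_smul]
    exact X_smul_mem_powFil_succ p x.2

/-! ## §2 The profile law `ℓ_{(T)}(X) = ∑_i e_i(X)` -/

/-- One step of the telescope: `ℓ_{(T)}(T^i X) = ℓ_{(T)}(T^{i+1} X) + e_{i+1}(X)` (additivity of local
lengths on `0 → T^{i+1}X → T^i X → gr_i X → 0`). [folklore] -/
theorem lengthAt_powFil_eq_succ_add (i : ℕ) :
    Module.lengthAt (IwasawaAlgebra p) (powFil p M i) (primeT p) =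
      Module.lengthAt (IwasawaAlgebra p) (powFil p M (i + 1)) (primeT p) + derivedLength p M i := by
  have hadd := Module.lengthAt_eq_add_of_exact (R := IwasawaAlgebra p)
    (M' := ↥(powFilSucc p M i)) (M := ↥(powFil p M i)) (M'' := grPiece p M i)
    (powFilSucc p M i).subtype (powFilSucc p M i).mkQ
    (Submodule.subtype_injective _) (Submodule.mkQ_surjective _)
    (LinearMap.exact_subtype_mkQ (powFilSucc p M i)) (primeT p)
  rw [hadd, Module.lengthAt_eq_of_linearEquiv
    (Submodule.comapSubtypeEquivOfLe (powFil_succ_le p M i)) (primeT p)]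
  rfl

/-- **Telescope**: `ℓ_{(T)}(X) = ℓ_{(T)}(T^n X) + ∑_{i<n} e_{i+1}(X)` for every `n`. [folklore] -/
theorem lengthAt_eq_lengthAt_powFil_add_sum (n : ℕ) :
    Module.lengthAt (IwasawaAlgebra p) M (primeT p) =
      Module.lengthAt (IwasawaAlgebra p) (powFil p M n) (primeT p) +
        ∑ i ∈ Finset.range n, derivedLength p M i := by
  induction n with
  | zero =>
    rw [Finset.range_zero, Finset.sum_empty, add_zero]
    exact (Module.lengthAt_eq_of_linearEquiv (LinearEquiv.ofTop (powFil p M 0) (powFil_zero p M))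
      (primeT p)).symm
  | succ n ih =>
    rw [ih, Finset.sum_range_succ, lengthAt_powFil_eq_succ_add p M n, add_assoc,
      add_comm (derivedLength p M n)]

/-- **Lower bounds**: every partial sum `∑_{i<n} e_{i+1}(X)` is `≤ ℓ_{(T)}(X)`. [folklore] -/
theorem sum_derivedLength_le (n : ℕ) :
    ∑ i ∈ Finset.range n, derivedLength p M i ≤ Module.lengthAt (IwasawaAlgebra p) M (primeT p) := by
  rw [lengthAt_eq_lengthAt_powFil_add_sum p M n]
  exact le_add_self

variable {M} in
/-- **The tail dies at `(T)`**: if `a · X = 0` with `a = T^N · b`, `b(0) ≠ 0` (`N = ord_T a`), then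
`(T^n X)_{(T)} = 0` for every `n ≥ N` — `T^n X` is killed by `b ∉ (T)`. [folklore] -/
theorem lengthAt_powFil_eq_zero {a : IwasawaAlgebra p} (ha0 : a ≠ 0) (ha : ∀ x : M, a • x = 0)
    {n : ℕ} (hn : a.order.toNat ≤ n) :
    Module.lengthAt (IwasawaAlgebra p) (powFil p M n) (primeT p) = 0 := by
  have hb : PowerSeries.constantCoeff (PowerSeries.divXPowOrder a) ≠ 0 := by
    rw [Ne, PowerSeries.constantCoeff_divXPowOrder_eq_zero_iff]
    exact ha0
  obtain ⟨k, hk⟩ := Nat.exists_eq_add_of_le hn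
  rw [Module.lengthAt_eq_zero_iff, LocalizedModule.subsingleton_iff]
  rintro ⟨x, hx⟩
  obtain ⟨y, rfl⟩ := (mem_powFil_iff p).mp hx
  refine ⟨PowerSeries.divXPowOrder a, ?_, ?_⟩
  · rw [Ideal.mem_primeCompl_iff, primeT_asIdeal, mem_span_X_iff]
    exact hb
  · apply Subtype.ext
    rw [Submodule.coe_smul, Submodule.coe_zero, smul_smul, hk, pow_add,
      show PowerSeries.divXPowOrder a * ((PowerSeries.X : IwasawaAlgebra p) ^ a.order.toNat *
          (PowerSeries.X : IwasawaAlgebra p) ^ k) =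
        ((PowerSeries.X : IwasawaAlgebra p) ^ a.order.toNat * PowerSeries.divXPowOrder a) *
          (PowerSeries.X : IwasawaAlgebra p) ^ k by ring,
      PowerSeries.X_pow_order_mul_divXPowOrder, mul_smul, ha]

variable {M} in
/-- Beyond the nilpotency bound the profile vanishes: `e_{n+1}(X) = 0` for `n ≥ ord_T a`
(`a ≠ 0` any annihilator of `X`). [folklore] -/
theorem derivedLength_eq_zero_of_le {a : IwasawaAlgebra p} (ha0 : a ≠ 0) (ha : ∀ x : M, a • x = 0)
    {n : ℕ} (hn : a.order.toNat ≤ n) : derivedLength p M n = 0 := by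
  have h := lengthAt_powFil_eq_succ_add p M n
  rw [lengthAt_powFil_eq_zero p ha0 ha hn, lengthAt_powFil_eq_zero p ha0 ha (hn.trans n.le_succ),
    zero_add] at h
  exact h.symm

variable {M} in
/-- **THE PROFILE LAW.** If `a · X = 0` (`a ≠ 0`) then for every `n ≥ ord_T a`,
`ℓ_{(T)}(X) = ∑_{i<n} e_{i+1}(X)`: the multiplicity of the augmentation prime in `X` is the total
mass of the derived coinvariant profile (for `X_{(T)} ≅ ⊕_j Λ_{(T)}/(T^{a_j})`: `∑_j a_j =
∑_i #{j : a_j > i}`, partition conjugation). This is the module-theoretic content of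
Bertolini–Darmon's `ord char = ∑_k rank S^{(k)}`. [cite: BertoliniDarmon1995, §2]
[cite: Howard2004DerivedHeights, Thm. 5.2 and Cor. 5.3] [cite: Washington1997, §13.2 (Thm. 13.12)] -/
theorem lengthAt_eq_sum_derivedLength {a : IwasawaAlgebra p} (ha0 : a ≠ 0)
    (ha : ∀ x : M, a • x = 0) {n : ℕ} (hn : a.order.toNat ≤ n) :
    Module.lengthAt (IwasawaAlgebra p) M (primeT p) = ∑ i ∈ Finset.range n, derivedLength p M i := by
  rw [lengthAt_eq_lengthAt_powFil_add_sum p M n, lengthAt_powFil_eq_zero p ha0 ha hn, zero_add]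

/-- **The profile law for finitely generated torsion modules** (existence form: a finitely generated
torsion module over the domain `Λ` has a non-zero annihilator): `ℓ_{(T)}(X) = ∑_{i<n} e_{i+1}(X)`
and `e_{n+1}(X) = 0` for all large `n`. [cite: BertoliniDarmon1995, §2] [cite: Washington1997, §13.2] -/
theorem exists_lengthAt_eq_sum_derivedLength [Module.Finite (IwasawaAlgebra p) M]
    (hM : Module.IsTorsion (IwasawaAlgebra p) M) :
    ∃ n₀ : ℕ, ∀ n, n₀ ≤ n →
      Module.lengthAt (IwasawaAlgebra p) M (primeT p) = ∑ i ∈ Finset.range n, derivedLength p M i ∧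
        derivedLength p M n = 0 := by
  obtain ⟨a, ha, ha0⟩ := Submodule.annihilator_top_inter_nonZeroDivisors hM
  have haM : ∀ x : M, a • x = 0 := fun x ↦ Submodule.mem_annihilator.mp ha x Submodule.mem_top
  exact ⟨a.order.toNat, fun n hn ↦ ⟨lengthAt_eq_sum_derivedLength p (nonZeroDivisors.ne_zero ha0) haM hn,
    derivedLength_eq_zero_of_le p (nonZeroDivisors.ne_zero ha0) haM hn⟩⟩

/-- **`ord_T f = ∑_i e_i(X)`** for a finitely generated torsion `Λ`-module `X` with `char_Λ X = (f)`,
killed by `a ≠ 0`, and `n ≥ ord_T a`: the order of vanishing of the characteristic power series at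
`T = 0` is the total mass of the derived coinvariant profile (`ord_T f = ℓ_{(T)}(X)` is the tree's
`order_eq_toNat_lengthAt`). [cite: BertoliniDarmon1995, §2] [cite: Washington1997, §13.2 (Thm. 13.12)] -/
theorem order_charGenerator_eq_sum_derivedLength [Module.Finite (IwasawaAlgebra p) M]
    (hM : Module.IsTorsion (IwasawaAlgebra p) M) (f : IwasawaAlgebra p)
    (hf : Module.charIdeal (IwasawaAlgebra p) M = Ideal.span {f})
    {a : IwasawaAlgebra p} (ha0 : a ≠ 0) (ha : ∀ x : M, a • x = 0) {n : ℕ}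
    (hn : a.order.toNat ≤ n) :
    f.order = ∑ i ∈ Finset.range n, derivedLength p M i := by
  rw [order_eq_toNat_lengthAt p hM f hf (primeT p) (primeT_asIdeal p),
    ENat.coe_toNat (lengthAt_primeT_ne_top M hM), lengthAt_eq_sum_derivedLength p ha0 ha hn]


/-! ## §3 The profile read over `ℤ_p`, and `e_1(X) = rank_{ℤ_p} X/TX` -/

section IntRank

variable [Module ℤ_[p] M] [IsScalarTower ℤ_[p] (IwasawaAlgebra p) M]

/-- **`e_{i+1}(X) = rank_{ℤ_p}(T^i X / T^{i+1} X)`**: a graded piece is killed by `T`, so its local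
length at `(T)` is its `ℤ_p`-rank (the tree's `lengthAt_eq_toENat_rank_of_X_smul_eq_zero`:
`Λ_{(T)}/T = Frac ℤ_p`). On the discrete side this is the `ℤ_p`-corank of Howard's `S^{(i+1)}`.
[cite: Howard2004DerivedHeights, Thm. 5.2] [cite: Washington1997, §13.2] -/
theorem derivedLength_eq_toENat_rank (i : ℕ) :
    derivedLength p M i = Cardinal.toENat (Module.rank ℤ_[p] (grPiece p M i)) :=
  lengthAt_eq_toENat_rank_of_X_smul_eq_zero p (X_smul_grPiece_eq_zero p M i) (primeT p)
    (primeT_asIdeal p)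

end IntRank

/-- `gr_0 X = X/TX`: the zeroth graded piece is the module of coinvariants. [folklore] -/
def grPieceZeroEquiv : grPiece p M 0 ≃ₗ[IwasawaAlgebra p] coinvariants p M :=
  Submodule.Quotient.equiv (powFilSucc p M 0)
    (Ideal.span {(PowerSeries.X : IwasawaAlgebra p)} • (⊤ : Submodule (IwasawaAlgebra p) M))
    (LinearEquiv.ofTop (powFil p M 0) (powFil_zero p M)) (by
      rw [← powFil_one]
      ext x
      simp only [Submodule.mem_map, powFilSucc, Submodule.mem_comap, Submodule.subtype_apply,
        LinearEquiv.coe_coe, LinearEquiv.ofTop_apply]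
      constructor
      · rintro ⟨y, hy, rfl⟩
        exact hy
      · intro hx
        exact ⟨⟨x, by rw [powFil_zero]; exact Submodule.mem_top⟩, hx, rfl⟩)

/-- `e_1(X) = ℓ_{(T)}(X/TX)`. [folklore] -/
theorem derivedLength_zero_eq_lengthAt_coinvariants :
    derivedLength p M 0 = Module.lengthAt (IwasawaAlgebra p) (coinvariants p M) (primeT p) :=
  Module.lengthAt_eq_of_linearEquiv (grPieceZeroEquiv p M) (primeT p)

/-- **`e_1(X) = rank_{ℤ_p} X/TX`** (`coinvariantsRank`) for finitely generated `X`: the first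
derived coinvariant length is the classical one, which Mazur control identifies with
`corank_{ℤ_p} Sel_{p^∞}(E/ℚ)` for `X = X(E/ℚ_∞)`. [cite: GreenbergLNM1716, Thm. 1.2 and §1 p. 65]
[cite: Washington1997, §13.2] -/
theorem derivedLength_zero_eq_coinvariantsRank [Module.Finite (IwasawaAlgebra p) M] :
    derivedLength p M 0 = (coinvariantsRank p M : ℕ∞) := by
  rw [derivedLength_zero_eq_lengthAt_coinvariants, lengthAt_coinvariants_eq_coinvariantsRank p M]

/-! ## §4 The profile is non-increasing: `e_1 ≥ e_2 ≥ e_3 ≥ ⋯` -/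

/-- Multiplication by `T`: `T^i X → T^{i+1} X`. [folklore] -/
def mulT (i : ℕ) : powFil p M i →ₗ[IwasawaAlgebra p] powFil p M (i + 1) :=
  (((LinearMap.lsmul (IwasawaAlgebra p) M) (PowerSeries.X : IwasawaAlgebra p)).domRestrict
    (powFil p M i)).codRestrict (powFil p M (i + 1)) fun x ↦ X_smul_mem_powFil_succ p x.2

/-- `mulT` is multiplication by `T` on underlying elements. [folklore] -/
theorem coe_mulT (i : ℕ) (x : powFil p M i) :
    (mulT p M i x : M) = (PowerSeries.X : IwasawaAlgebra p) • (x : M) := rfl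

/-- Multiplication by `T` on graded pieces: `gr_i X → gr_{i+1} X` (the algebraic shadow of passing
from the `i`-th to the `(i+1)`-st derived height). [cite: BertoliniDarmon1995, §2] [cite: Howard2004DerivedHeights, §2] -/
def grMulT (i : ℕ) : grPiece p M i →ₗ[IwasawaAlgebra p] grPiece p M (i + 1) :=
  Submodule.mapQ (powFilSucc p M i) (powFilSucc p M (i + 1)) (mulT p M i) fun x hx ↦ by
    rw [Submodule.mem_comap]
    show ((mulT p M i x : powFil p M (i + 1)) : M) ∈ powFil p M (i + 1 + 1)
    rw [coe_mulT]
    exact X_smul_mem_powFil_succ p hx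

/-- `gr_i X → gr_{i+1} X` is onto (`T · T^i y = T^{i+1} y`). [folklore] -/
theorem grMulT_surjective (i : ℕ) : Function.Surjective (grMulT p M i) := by
  intro q
  induction q using Submodule.Quotient.induction_on with
  | H z =>
    obtain ⟨y, hy⟩ := (mem_powFil_iff p).mp z.2
    refine ⟨Submodule.Quotient.mk ⟨(PowerSeries.X : IwasawaAlgebra p) ^ i • y,
      pow_smul_mem_powFil p i y⟩, ?_⟩
    rw [grMulT, Submodule.mapQ_apply]
    congr 1
    apply Subtype.ext
    rw [coe_mulT, ← mul_smul, ← pow_succ', hy]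

/-- **The derived coinvariant profile is non-increasing**: `e_{i+2}(X) ≤ e_{i+1}(X)` (a quotient has
smaller local length). For `X ∼ ⊕_j Λ/(T^{a_j}) ⊕ …`: `#{j : a_j > i+1} ≤ #{j : a_j > i}`.
[cite: BertoliniDarmon1995, §2] [cite: Washington1997, §13.2] -/
theorem derivedLength_succ_le (i : ℕ) : derivedLength p M (i + 1) ≤ derivedLength p M i :=
  length_localizedModule_primeT_le_of_surjective (p := p) (grMulT p M i) (grMulT_surjective p M i)

/-- The profile is antitone: `i ≤ j ⇒ e_{j+1}(X) ≤ e_{i+1}(X)`. [folklore] -/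
theorem derivedLength_antitone : Antitone (derivedLength p M) :=
  antitone_nat_of_succ_le (derivedLength_succ_le p M)

variable {M} in
/-- Once a derived length vanishes, all later ones do. [folklore] -/
theorem derivedLength_eq_zero_of_eq_zero {i j : ℕ} (hij : i ≤ j) (hi : derivedLength p M i = 0) :
    derivedLength p M j = 0 :=
  nonpos_iff_eq_zero.mp (hi ▸ derivedLength_antitone p M hij)

variable {M} in
/-- A vanishing derived length truncates the profile law: if `e_{m+1}(X) = 0` then every partial sum
from `m` on is `0`. [folklore] -/
theorem sum_Ico_derivedLength_eq_zero {m n : ℕ} (hm : derivedLength p M m = 0) :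
    ∑ i ∈ Finset.Ico m n, derivedLength p M i = 0 :=
  Finset.sum_eq_zero fun _ hi ↦ derivedLength_eq_zero_of_eq_zero p (Finset.mem_Ico.mp hi).1 hm

/-- Each derived length is bounded by the total multiplicity: `e_{i+1}(X) ≤ ℓ_{(T)}(X)`. [folklore] -/
theorem derivedLength_le_lengthAt (i : ℕ) :
    derivedLength p M i ≤ Module.lengthAt (IwasawaAlgebra p) M (primeT p) :=
  (Finset.single_le_sum (f := derivedLength p M) (fun _ _ ↦ zero_le)
    (Finset.self_mem_range_succ i)).trans (sum_derivedLength_le p M (i + 1))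


end Summit.BirchSwinnertonDyer.BirchSwinnertonDyer.Theorems.DerivedCoinvariantProfile
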